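import Summits.AtomisticToContinuum.HydrodynamicLimit.Theorems.OneFlightGossipEngineClampedCurrentsDockKineticInstance
import Summits.AtomisticToContinuum.HydrodynamicLimit.Theorems.ImplosionDichotomyHydroLimitInBandSignedBandDefs
import HarnessLib

/-!
# KC1 with the orthogonality of the cut-off exported (stub `stub_kineticInstanceOrth`, line `IdeatorOneSketch`,
# crux `HydroLimitInBand`, stmt-AtomisticToContinuum-9133)

Support file (`--supports stmt-AtomisticToContinuum-9133`) proving the registered stub
`stub_kineticInstanceOrth : KineticInstanceOrth` of the reshaped line `IdeatorOneSketch` (skeleton v16); the statement is the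
def `HydroLimitInBandSignedBand.KineticInstanceOrth` of the landed statements file
`Theorems/ImplosionDichotomyHydroLimitInBandSignedBandDefs.lean`. It is the landed kinetic instance KC1
(`ClampedCurrentsDockKineticInstance.stub_kineticInstance`, `Theorems/OneFlightGossipEngineClampedCurrentsDockKineticInstance.lean`)
with ONE extra conjunct in the conclusion: the momentum orthogonality under the local Maxwellian of the odd class member
`(b·w) G_s(x,|w|²)`, `w = v − u_s(x)`, for the heat-flux coefficient `b = ∇θ/(2θ²)` on the slab `[0,t₁]` — the momentum row of the
re-orthogonalised low-speed heat-flux cut-off along families (S11F, `LoHeatFluxCutoffFamily`), which the landed proof obtains for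
the clamped families and uses internally but does not export. The signed cubic channel of v16 consumes it.

Proof: the landed proof of `stub_kineticInstance` verbatim (clamp the parameter to the slab, build the clamped coefficient
families, take the cut-off `G` of hypothesis 2 along them, verify the class hypotheses of KCWU by the Gaussian toolkit of
`…KineticInstanceClass.lean`, read hypothesis 1 on the slab), plus the momentum row `hO1` of hypothesis 2 read on the slab, where the
clamp is the identity. prover-line-stmt-AtomisticToContinuum-9133-c17-0 (stub worker `stub_kineticInstanceOrth`).
-/

noncomputable section

namespace Summit.AtomisticToContinuum.HydrodynamicLimit.Theorems.HydroLimitInBandKineticInstanceOrth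

open scoped BigOperators ENNReal Classical Interval
open MeasureTheory Filter Set Topology InformationTheory
open Literature.MathematicalPhysics.KineticTheory Literature.Analysis.FluidPDE Literature.Analysis.FunctionSpaces
open ProbabilityTheory
open Summit.AtomisticToContinuum.HydrodynamicLimit.Theorems.KineticCurrentsWindowLDUniformSketch.ClassTruncation
open Summit.AtomisticToContinuum.HydrodynamicLimit.Theorems.ClampedCurrentsDockKineticInstance
open Summit.AtomisticToContinuum.HydrodynamicLimit.Theorems.HydroLimitInBandSignedBand (KineticInstanceOrth)

/-! ## The stub -/

/-- **KC1 with the momentum orthogonality of the cut-off exported** (registered stub `stub_kineticInstanceOrth` of line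
IdeatorOneSketch, crux HydroLimitInBand, stmt-AtomisticToContinuum-9133): KCWU along families, applied along the reference
family clamped to the slab `[0,t₁]` with the re-orthogonalised cut-off of S11-family and the traceless-stress/low-heat-flux
class member, read on the slab, together with the momentum row `∫ (b·w) G v_k M = 0`, `b = ∇θ/(2θ²)`, of S11-family on the
slab. [folklore] -/
theorem stub_kineticInstanceOrth : KineticInstanceOrth := by
  -- adapted from Theorems/OneFlightGossipEngineClampedCurrentsDockKineticInstance.lean (stub_kineticInstance)
  intro hK hL
  obtain ⟨η₀, hη₀, hKC⟩ := hK
  refine ⟨η₀, hη₀, ?_⟩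
  intro t₁ a θ u ht₁ hac hapos hθ hu hθpos σ hσ hguard Φ Kstar hKstar
  -- (i) the clamp `p s = max 0 (min t₁ s)`
  obtain ⟨p, hp⟩ : ∃ p : ℝ → ℝ, p = fun s => max 0 (min t₁ s) := ⟨_, rfl⟩
  have hpc : Continuous p := by
    rw [hp]; exact continuous_const.max (continuous_const.min continuous_id)
  have hpm : ∀ s, p s ∈ Icc 0 t₁ := fun s => by
    rw [hp]; exact ⟨le_max_left _ _, max_le ht₁ (min_le_left _ _)⟩
  have hpid : ∀ s ∈ Icc 0 t₁, p s = s := fun s hs => by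
    rw [hp]; show max 0 (min t₁ s) = s; rw [min_eq_right hs.2, max_eq_right hs.1]
  -- slab continuity of the data and of their space derivatives
  have hθc0 : ContinuousOn (Function.uncurry θ) (Icc 0 t₁ ×ˢ univ) :=
    Torus.continuousOn_uncurry_of_continuousOn_stLift hθ.continuousOn_stLift
  have huc0 : ContinuousOn (Function.uncurry u) (Icc 0 t₁ ×ˢ univ) :=
    Torus.continuousOn_uncurry_of_continuousOn_stLift hu.continuousOn_stLift
  have hDθ0 : ∀ k : Fin 3, ContinuousOn
      (Function.uncurry fun s x => Torus.partialDeriv k (θ s) x) (Icc 0 t₁ ×ˢ univ) :=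
    fun k => continuousOn_partialDeriv_slab ht₁ hθ k
  have hDu0 : ∀ j k : Fin 3, ContinuousOn
      (Function.uncurry fun s x => Torus.partialDeriv k (fun y => u s y j) x) (Icc 0 t₁ ×ˢ univ) :=
    fun j k => continuousOn_partialDeriv_slab ht₁ (hu.apply j) k
  -- bounds on the slab
  obtain ⟨θm, hθm0, hθm⟩ := exists_pos_le_slab ht₁ hθc0 hθpos
  obtain ⟨θM, hθM⟩ := exists_abs_le_slab hθc0
  obtain ⟨U, hU⟩ := hu.exists_norm_le_of_isCompact isCompact_Icc subset_rfl
  choose Mθ hMθ using fun k : Fin 3 => exists_abs_le_slab (hDθ0 k)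
  choose Mu hMu using fun j k : Fin 3 => exists_abs_le_slab (hDu0 j k)
  obtain ⟨MD, hMD0, hMθ', hMu'⟩ : ∃ MD : ℝ, 0 ≤ MD ∧
      (∀ k, ∀ s ∈ Icc 0 t₁, ∀ x, |Torus.partialDeriv k (θ s) x| ≤ MD) ∧
      (∀ j k, ∀ s ∈ Icc 0 t₁, ∀ x, |Torus.partialDeriv k (fun y => u s y j) x| ≤ MD) := by
    refine ⟨(∑ k, |Mθ k|) + ∑ j, ∑ k, |Mu j k|, by positivity, fun k s hs x => ?_,
      fun j k s hs x => ?_⟩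
    · have h1 : |Mθ k| ≤ ∑ k, |Mθ k| :=
        Finset.single_le_sum (fun i _ => abs_nonneg (Mθ i)) (Finset.mem_univ k)
      have h2 : 0 ≤ ∑ j, ∑ k, |Mu j k| := by positivity
      linarith [hMθ k s hs x, le_abs_self (Mθ k)]
    · have h1 : |Mu j k| ≤ ∑ k, |Mu j k| :=
        Finset.single_le_sum (fun i _ => abs_nonneg (Mu j i)) (Finset.mem_univ k)
      have h2 : ∑ k, |Mu j k| ≤ ∑ j, ∑ k, |Mu j k| :=
        Finset.single_le_sum (f := fun j => ∑ k, |Mu j k|)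
          (fun i _ => Finset.sum_nonneg fun k _ => abs_nonneg (Mu i k)) (Finset.mem_univ j)
      have h3 : 0 ≤ ∑ k, |Mθ k| := by positivity
      linarith [hMu j k s hs x, le_abs_self (Mu j k)]
  -- the clamped families and the clamped coefficient families
  set θc : ℝ → T3 → ℝ := fun s x => θ (p s) x with hθc_def
  set uc : ℝ → T3 → V3 := fun s x => u (p s) x with huc_def
  set ac : ℝ → T3 → ℝ := fun s x => a (p s) x with hac_def
  set Du : ℝ → T3 → Fin 3 → Fin 3 → ℝ :=
    fun s x j k => Torus.partialDeriv k (fun y => u (p s) y j) x with hDu_def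
  set Dθ : ℝ → T3 → Fin 3 → ℝ := fun s x k => Torus.partialDeriv k (θ (p s)) x with hDθ_def
  set Ac : ℝ → T3 → Fin 3 → Fin 3 → ℝ := fun s x j k =>
    (θc s x)⁻¹ * (Du s x j k - if j = k then (∑ l, Du s x l l) / 3 else 0) with hAc_def
  set bc : ℝ → T3 → V3 := fun s x =>
    WithLp.toLp 2 fun k => Dθ s x k / (2 * θc s x ^ 2) with hbc_def
  have hθc_pos : ∀ s x, 0 < θc s x := fun s x => hθpos (p s) (hpm s) x
  have hac_pos : ∀ s x, 0 < ac s x := fun s x => hapos (p s) (hpm s) x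
  have hθm_c : ∀ s x, θm ≤ θc s x := fun s x => hθm (p s) (hpm s) x
  have hθM_c : ∀ s x, θc s x ≤ θM := fun s x => (abs_le.1 (hθM (p s) (hpm s) x)).2
  have hU_c : ∀ s x, ‖uc s x‖ ≤ U := fun s x => hU (p s) (hpm s) x
  have hDθ_bd : ∀ s x k, |Dθ s x k| ≤ MD := fun s x k => hMθ' k (p s) (hpm s) x
  have hDu_bd : ∀ s x j k, |Du s x j k| ≤ MD := fun s x j k => hMu' j k (p s) (hpm s) x
  -- continuity of the clamped families (global, jointly)
  have hθc_c : Continuous (Function.uncurry θc) := continuous_clamp hpc hpm hθc0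
  have huc_c : Continuous (Function.uncurry uc) := continuous_clamp hpc hpm huc0
  have hac_c : Continuous (Function.uncurry ac) := continuous_clamp hpc hpm hac
  have hθc_c' : Continuous fun q : ℝ × T3 => θc q.1 q.2 := by
    simpa only [Function.uncurry_def] using hθc_c
  have hDθ_c : ∀ k, Continuous fun q : ℝ × T3 => Dθ q.1 q.2 k := fun k => by
    simpa only [Function.uncurry_def] using continuous_clamp hpc hpm (hDθ0 k)
  have hDu_c : ∀ j k, Continuous fun q : ℝ × T3 => Du q.1 q.2 j k := fun j k => by
    simpa only [Function.uncurry_def] using continuous_clamp hpc hpm (hDu0 j k)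
  have hθinv : Continuous fun q : ℝ × T3 => (θc q.1 q.2)⁻¹ :=
    hθc_c'.inv₀ fun q => (hθc_pos q.1 q.2).ne'
  have hAc_c : Continuous (Function.uncurry Ac) := by
    refine continuous_pi fun j => continuous_pi fun k => ?_
    simp only [Function.uncurry_def, hAc_def]
    refine hθinv.mul ((hDu_c j k).sub ?_)
    split_ifs
    · exact (continuous_finsetSum _ fun l _ => hDu_c l l).div_const _
    · exact continuous_const
  have hbc_c : Continuous (Function.uncurry bc) := by
    have h : ∀ k, Continuous fun q : ℝ × T3 => Dθ q.1 q.2 k / (2 * θc q.1 q.2 ^ 2) := fun k =>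
      (hDθ_c k).div (continuous_const.mul (hθc_c'.pow 2)) fun q =>
        (mul_pos two_pos (pow_pos (hθc_pos q.1 q.2) 2)).ne'
    simp only [Function.uncurry_def, hbc_def]
    exact (PiLp.continuous_toLp 2 _).comp (continuous_pi h)
  -- bounds of the clamped coefficient families
  have hbc_bd : ∀ s x, ‖bc s x‖ ≤ 3 * (MD / (2 * θm ^ 2)) := fun s x => by
    refine norm_le_three_mul (bc s x) fun k => ?_
    show |Dθ s x k / (2 * θc s x ^ 2)| ≤ MD / (2 * θm ^ 2)
    rw [abs_div, abs_of_pos (mul_pos two_pos (pow_pos (hθc_pos s x) 2))]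
    exact div_le_div₀ hMD0 (hDθ_bd s x k) (mul_pos two_pos (pow_pos hθm0 2))
      (mul_le_mul_of_nonneg_left (pow_le_pow_left₀ hθm0.le (hθm_c s x) 2) two_pos.le)
  have hAc_bd : ∀ s x j k, |Ac s x j k| ≤ θm⁻¹ * (MD + MD) := by
    intro s x j k
    have hc : |(if j = k then (∑ l, Du s x l l) / 3 else 0 : ℝ)| ≤ MD := by
      split_ifs
      · rw [abs_div, abs_of_pos (by norm_num : (0 : ℝ) < 3), Fin.sum_univ_three]
        have h0 := hDu_bd s x 0 0
        have h1 := hDu_bd s x 1 1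
        have h2 := hDu_bd s x 2 2
        have h3 := abs_add_three (Du s x 0 0) (Du s x 1 1) (Du s x 2 2)
        linarith
      · rw [abs_zero]; exact hMD0
    show |(θc s x)⁻¹ * (Du s x j k - if j = k then (∑ l, Du s x l l) / 3 else 0)| ≤ _
    rw [abs_mul, abs_inv, abs_of_pos (hθc_pos s x)]
    exact mul_le_mul (inv_anti₀ hθm0 (hθm_c s x))
      ((abs_sub _ _).trans (add_le_add (hDu_bd s x j k) hc)) (abs_nonneg _)
      (inv_nonneg.2 hθm0.le)
  have htr : ∀ s x, ∑ j, Ac s x j j = 0 := fun s x => trace_free (θc s x)⁻¹ (Du s x)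
  -- (ii) the cut-off profile `G` of hypothesis 2 along the clamped families
  obtain ⟨G, hGc, ⟨CG, hCG⟩, hGagree, ⟨CF, hCF⟩, hO0, hO1, hO2⟩ :=
    hL θc uc bc hθc_c huc_c hbc_c ⟨θm, hθm0, hθm_c⟩ ⟨θM, hθM_c⟩ ⟨U, hU_c⟩
      ⟨3 * (MD / (2 * θm ^ 2)), hbc_bd⟩ Kstar hKstar
  have hGsx : ∀ (s : ℝ) (x : T3), Continuous fun r : ℝ => G s (x, r) := fun s x =>
    hGc.comp (continuous_const.prodMk (continuous_const.prodMk continuous_id))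
  -- (iii) the class hypotheses of KCWU for the member `Σ Ac w w + (bc·w) G`
  have hMA0 : 0 ≤ θm⁻¹ * (MD + MD) := mul_nonneg (inv_nonneg.2 hθm0.le) (by linarith)
  have hCB : ∀ (s : ℝ) (x : T3) (v : V3),
      |(∑ j, ∑ k, Ac s x j k * ((v - uc s x) j * (v - uc s x) k)) +
        (∑ j, bc s x j * (v - uc s x) j) * G s (x, ‖v - uc s x‖ ^ 2)| ≤
        (9 * (θm⁻¹ * (MD + MD)) * (2 + 2 * U ^ 2) + CF) * (1 + ‖v‖ ^ 2) := by
    intro s x v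
    refine (abs_add_le _ _).trans ?_
    have h2 : |(∑ j, bc s x j * (v - uc s x) j) * G s (x, ‖v - uc s x‖ ^ 2)| ≤
        CF * (1 + ‖v‖ ^ 2) := hCF s (x, v)
    have hS : ∑ j, ∑ k, |Ac s x j k| ≤ 9 * (θm⁻¹ * (MD + MD)) := by
      calc ∑ j, ∑ k, |Ac s x j k| ≤ ∑ j : Fin 3, ∑ k : Fin 3, θm⁻¹ * (MD + MD) :=
            Finset.sum_le_sum fun j _ => Finset.sum_le_sum fun k _ => hAc_bd s x j k
        _ = 9 * (θm⁻¹ * (MD + MD)) := by simp only [Fin.sum_univ_three]; ring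
    have hu2 : 2 + 2 * ‖uc s x‖ ^ 2 ≤ 2 + 2 * U ^ 2 := by
      nlinarith [hU_c s x, norm_nonneg (uc s x)]
    have hv : 0 ≤ 1 + ‖v‖ ^ 2 := by positivity
    have hq : |∑ j, ∑ k, Ac s x j k * ((v - uc s x) j * (v - uc s x) k)| ≤
        9 * (θm⁻¹ * (MD + MD)) * (2 + 2 * U ^ 2) * (1 + ‖v‖ ^ 2) :=
      calc _ ≤ (∑ j, ∑ k, |Ac s x j k|) * (2 + 2 * ‖uc s x‖ ^ 2) * (1 + ‖v‖ ^ 2) :=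
            quad_growth (uc s x) (Ac s x) v
        _ ≤ 9 * (θm⁻¹ * (MD + MD)) * (2 + 2 * ‖uc s x‖ ^ 2) * (1 + ‖v‖ ^ 2) :=
            mul_le_mul_of_nonneg_right (mul_le_mul_of_nonneg_right hS (by positivity)) hv
        _ ≤ 9 * (θm⁻¹ * (MD + MD)) * (2 + 2 * U ^ 2) * (1 + ‖v‖ ^ 2) :=
            mul_le_mul_of_nonneg_right (mul_le_mul_of_nonneg_left hu2 (by positivity)) hv
    linarith
  have hOrth : ∀ (s : ℝ) (x : T3),
      (∫ v, ((∑ j, ∑ k, Ac s x j k * ((v - uc s x) j * (v - uc s x) k)) +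
          (∑ j, bc s x j * (v - uc s x) j) * G s (x, ‖v - uc s x‖ ^ 2)) *
          localMaxwellian 1 (θc s x) (uc s x) v = 0) ∧
      (∀ k, ∫ v, ((∑ j, ∑ k, Ac s x j k * ((v - uc s x) j * (v - uc s x) k)) +
          (∑ j, bc s x j * (v - uc s x) j) * G s (x, ‖v - uc s x‖ ^ 2)) * v k *
          localMaxwellian 1 (θc s x) (uc s x) v = 0) ∧
      ∫ v, ((∑ j, ∑ k, Ac s x j k * ((v - uc s x) j * (v - uc s x) k)) +
          (∑ j, bc s x j * (v - uc s x) j) * G s (x, ‖v - uc s x‖ ^ 2)) * ‖v‖ ^ 2 *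
          localMaxwellian 1 (θc s x) (uc s x) v = 0 := fun s x =>
    member_orth (hθc_pos s x) (uc s x) (A := Ac s x) (htr s x) (bc s x)
      (Gx := fun r => G s (x, r)) (hGsx s x) (CF := CF) (fun v => hCF s (x, v))
      (hO0 s x) (hO1 s x) (hO2 s x)
  have hguard_c : ∀ s ∈ Icc 0 t₁, σ ^ 3 * (⨆ x, ac s x) ≤ η₀ * ∫ x, ac s x := fun s hs => by
    simp only [hac_def, hpid s hs]; exact hguard s hs
  -- (iv) KCWU along the clamped families
  obtain ⟨β₀, hβ₀, hβ⟩ := hKC t₁ ac θc uc hac_c hθc_c huc_c hac_pos hθc_pos σ hσ hguard_c Φ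
    Ac bc G hAc_c hbc_c hGc ⟨_, fun s _ y => hCB s y.1 y.2⟩ (fun s _ x => (hOrth s x).1)
    (fun s _ x j => (hOrth s x).2.1 j) (fun s _ x => (hOrth s x).2.2)
  refine ⟨G, hGc.continuousOn, ⟨CG, fun s _ y hy => hCG s y hy⟩, fun s hs x s' hs' => ?_,
    fun s hs x k => ?_, β₀, hβ₀, fun β hββ ε hε => ?_⟩
  · rw [hGagree s x s' hs']
    simp only [hθc_def, hpid s hs]
  · -- the exported momentum row of S11F, read on the slab (the clamp is the identity there)
    have h1 := hO1 s x k
    simpa only [hbc_def, hθc_def, huc_def, hDθ_def, hpid s hs, PiLp.toLp_apply] using h1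
  · obtain ⟨τ₀, hτ₀, hτ⟩ := hβ β hββ ε hε
    refine ⟨τ₀, hτ₀, fun τ hττ => ?_⟩
    obtain ⟨N₀, hN⟩ := hτ τ hττ
    refine ⟨N₀, fun N hNN s hs => ?_⟩
    have hfin := hN N hNN s hs
    simpa only [hac_def, hθc_def, huc_def, hAc_def, hbc_def, hDu_def, hDθ_def, hpid s hs,
      PiLp.toLp_apply, traceless_form] using hfin

end Summit.AtomisticToContinuum.HydrodynamicLimit.Theorems.HydroLimitInBandKineticInstanceOrth

end
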